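import Summits.KontsevichZagierPeriods.KontsevichZagierPeriods.Theorems.RootDecompRationalCubeDichotomyNashMultiGenP16

/-!
# Route B — item 33042 `MultiGenSpecial`: the registered line `slice` (v3, single residual ∀ d ≥ 2, SliceNash d), stub `stub_edge` BY NAME AND SIGNATURE

The registered skeleton «slice» v3 on stmt-KontsevichZagierPeriods-33042 (writer decomp-kz-writer-1 g6, namespace `…Cruxes.MultiGenSpecial.Slice`; critic rulings
13:43:10Z (ii) / 13:56:10Z) has two stubs: `stub_sliceGe2 : Statement.stub_sliceGe2` (the residual «∀ d ≥ 2, SliceNash d», size L–XL — OPEN) and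
`stub_edge : Statement.stub_sliceGe2 → MultiGenSpecial` (the kernel edge).  This module reproduces `def Statement.stub_sliceGe2` VERBATIM
(a6/origin/Sge2_sig.txt) and proves `stub_edge` by the lens-2 g8 v8 theorem `item33042_of_sliceNash_geTwo` (§6.9, landed in the census chain
`…NashMultiGenP01–P16`) — `Statement.stub_sliceGe2 ↔ ∀ d, 2 ≤ d → SliceNash d` and `Item33042 ↔ MultiGenSpecial` are `Iff.rfl`.
-/

set_option linter.dupNamespace false

namespace Summit.KontsevichZagierPeriods.KontsevichZagierPeriods.Cruxes.MultiGenSpecial.Slice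

/-- the STATEMENT of `stub_sliceGe2` ("∀ d ≥ 2, SliceNash d"): δ-expansion of lens-2 g8 `∀ d : ℕ, 2 ≤ d → SliceNash d` (verbatim, skeleton «slice» v3, a6/origin/Sge2_sig.txt). -/
def Statement.stub_sliceGe2 : Prop := ∀ d : ℕ, 2 ≤ d → ∀ (m : ℕ) (s₀ : Fin m → ℝ), AlgebraicIndependent ℚ s₀ → ∀ (g : (Fin (m + d) → ℝ) → ℝ) (U : Set (Fin (m + d) → ℝ)), IsOpen U → (Fin.append s₀ (0 : Fin d → ℝ) : Fin (m + d) → ℝ) ∈ U → Literature.NumberTheory.Transcendental.IsSemialgebraicFunOn ℚ U g → AnalyticOnNhd ℝ g U → ∃ (k : ℕ) (y₀ : Fin k → ℝ) (F : Fin k → MvPolynomial (Fin (m + d + k)) ℚ) (A B : MvPolynomial (Fin (m + d + k)) ℚ), (∀ i, MvPolynomial.aeval (Fin.append (Fin.append s₀ (0 : Fin d → ℝ)) y₀ : Fin (m + d + k) → ℝ) (F i) = 0) ∧ (Matrix.of fun i j : Fin k => MvPolynomial.aeval (Fin.append (Fin.append s₀ (0 : Fin d → ℝ)) y₀ : Fin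 (m + d + k) → ℝ) (MvPolynomial.pderiv (Fin.natAdd (m + d) j) (F i))).det ≠ 0 ∧ MvPolynomial.aeval (Fin.append (Fin.append s₀ (0 : Fin d → ℝ)) y₀ : Fin (m + d + k) → ℝ) B ≠ 0 ∧ ∀ (V : Set (Fin d → ℝ)) (u : Fin k → (Fin d → ℝ) → ℝ), IsOpen V → (0 : Fin d → ℝ) ∈ V → (∀ j, u j 0 = y₀ j) → (∀ j, AnalyticOnNhd ℝ (u j) V) → (∀ t ∈ V, ∀ i, MvPolynomial.aeval (Fin.append (Fin.append s₀ t) (fun j => u j t) : Fin (m + d + k) → ℝ) (F i) = 0) → ∃ W ⊆ V, IsOpen W ∧ (0 : Fin d → ℝ) ∈ W ∧ ∀ t ∈ W, g (Fin.append s₀ t) = MvPolynomial.aeval (Fin.append (Fin.append s₀ t) (fun j => u j t) : Fin (m + d + k) → ℝ) A / MvPolynomial.aeval (Fin.append (Fin.append s₀ t) (fun j => u j t) : Fin (m + d + k) → ℝ) B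

/-- the skeleton def IS the lens's `∀ d ≥ 2, SliceNash d` -/
theorem statement_stub_sliceGe2_iff : Statement.stub_sliceGe2 ↔ ∀ d : ℕ, 2 ≤ d → Summit.KontsevichZagierPeriods.RootDecompRationalCubeDichotomy.Rung29430.MultiGen.SliceNash d := Iff.rfl

/-- the lens's mirror `Item33042` IS the born route decl `MultiGenSpecial` -/
private theorem item33042_iff_born : Summit.KontsevichZagierPeriods.RootDecompRationalCubeDichotomy.Rung29430.MultiGen.Item33042 ↔ Summit.KontsevichZagierPeriods.KontsevichZagierPeriods.Theses.RootDecompRationalCubeDichotomy.MultiGenSpecial := Iff.rfl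

/-- **`stub_edge` of line «slice» (v3) on item 33042, PROVED** (the kernel edge (∀ d ≥ 2, SliceNash d) ⟹ MultiGenSpecial) — by
`MultiGen.item33042_of_sliceNash_geTwo` (lens-2 g8 §6.9: at a point with ¬DefectLeOne the generic chart has codimension ≥ 2). -/
theorem stub_edge :
    Statement.stub_sliceGe2 → Summit.KontsevichZagierPeriods.KontsevichZagierPeriods.Theses.RootDecompRationalCubeDichotomy.MultiGenSpecial :=
  fun h => item33042_iff_born.mp (Summit.KontsevichZagierPeriods.RootDecompRationalCubeDichotomy.Rung29430.MultiGen.item33042_of_sliceNash_geTwo (statement_stub_sliceGe2_iff.mp h))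

end Summit.KontsevichZagierPeriods.KontsevichZagierPeriods.Cruxes.MultiGenSpecial.Slice
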